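import Summits.Ventures.CertifiedManyBodySolver.Downfold.EmeryBoxesNCCOK26ThermalCapWord
import Summits.Ventures.CertifiedManyBodySolver.Downfold.EmeryThermalCapRetiltBoxp1
import Literature.MathematicalPhysics.QuantumLattice.EmeryThreeBandThermalMarkovCap
import HarnessLib

/-!
# RE-TILTED and ENTROPY-RESOLVED `T > 0` CAP WORDS on `emeryBoxNCCOK26` (level εp = -8): the four kgp1x5 corner sector tables read SECTOR-WISE at the common level
# tighten hubbard-downfold-mod-4's cap word `42.2175·β + 6 log 2 → 36.2175·β + 6 log 2` (re-tilt) `→ maxᵢ log Fᵢ(β)` (Markov; `36.2175·β + log 15 = 36.2175·β + 2.7081` as β → ∞); hubbard-box-p1 g23, by value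

Venture CertifiedManyBodySolver, cell `pub/hubbard-downfold` (S1 = ROUTER) × crew hubbard-fast S2 (ii) × (iv) «T > 0 × multi-band» (D-0096 (ii)); seat hubbard-box-p1
(row «Lipschitz / joint laws in (U, μ) of certified objects; box ⊂ ∪ cells ⇒ word»), by value for the word owner hubbard-downfold-mod-4 (COVERAGE BATCH 3 cap words).
Namespace `Summit.Ventures.CertifiedManyBodySolver.Downfold`. Same constructions as `EmeryBoxes<X>ThermalCapRetiltBoxp1` (g21, ask «RE-TILT law» hubbard-fast INBOX
2026-08-28T18:54:56Z (a)) and `EmeryBoxes<X>ThermalMarkovCapBoxp1` (g22) for the batch-1/2 boxes, merged into one file.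

INPUTS BY NAME: `EmeryBoxesNCCOK26ThermalCapWord` (cap word `emeryBoxNCCOK26_pressureCap_m8` at εp = -8 by MONOTONE level transfer of the four corner certificates `nCCOK26Floor_hq_lowerCorner`,
tilts `μ = (-8, -9, -43/5, -19/2)`, `q₀ = (-2654597/40000, -6279593/80000, -1467193/20000, -3377403/40000)`); `EmeryBoxesNCCOK26FloorWord` (table identities `nCCOK26Floor_tau/ups/nu i`); the kgp1x5 sector tables
`kgp1x5_<c>_table` / `_sigma` (NCCOx_c0_ll_mum80o10, NCCOx_c1_hl_mum90o10, NCCOx_c2_lh_mum86o10, NCCOx_c3_hh_mum95o10; device hubbard-box-p2, batch 3 run by hubbard-downfold-mod-4); the Literature laws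
`EmeryThreeBandCuO4CertificateRetilt` (`posSemidef_cuO4_uniform_retilt_of_sectorFloors`, `sectorFloors_plusGP_retilt`: at M = 2 the shift of sector `k` under `θ ↦ θ + c·ε`
is `≥ max(c·k + min(0, 2c), 2c·k − 4·max(0, 2c))`, `cᵢ = εp − μᵢ = (0, 1, 3/5, 3/2)`) and `EmeryThreeBandThermalMarkovCap`
(`emeryCellPressure_le_log_of_gpSectorFloors`: `P_cell ≤ log max_{n≤4} Σ_{j≤6} C(6,j)·e^{−(β/2)·q(j+n)}` from sector floors `q` of the plus); the box doors
`holdsOn_emeryCellPressureCap_of_tiltedCuO4Certificates` (`EmeryThermalBandSeam`) and `holdsOn_emeryCellPressureCap_of_cornerCaps` (`EmeryThermalSeam`).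

RE-TILTED CONSTANTS at εp = -8 (exact; binding sector in brackets): q₀′ = (-2654597/40000 [k = 8, c = 0], -5639593/80000 [k = 8, c = 1], -5480573/80000 [k = 8, c = 3/5], -2897403/40000 [k = 8, c = 3/2]);
slopes `−q₀′/2 = (33.1825, 35.2475, 34.2536, 36.2175)` ⇒ **flat box cap constant `2897403/80000 = 36.2175375`** (corner 3 binds) versus `3377403/80000 = 42.2175375` of record; the cap word states no same-level floor family for this object, so no T > 0 window is stated here either (the T = 0 floor word is).
ENTROPY-RESOLVED WORD BY VALUE [float, 4 dp, `gen-g23/gen_retilt_markov_box.py`; exact rationals inside the theorems]: flat re-tilted `36.2175·β + 6 log 2` vs Markov `maxᵢ log Fᵢ(β)`: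
| β (1/eV) | flat re-tilted | Markov | gain (nats/CuO₂) |
|---|---|---|---|
| 0.05 | 5.9698 | 5.8424 | 0.1274 |
| 0.1 | 7.7806 | 7.5381 | 0.2426 |
| 0.5 | 22.2677 | 21.4071 | 0.8606 |
| 1 | 40.3764 | 39.1653 | 1.2111 |
| 5 | 185.2466 | 183.7960 | 1.4506 |
| 10 | 366.3343 | 364.8834 | 1.4508 |
| 40 | 1452.8604 | 1451.4096 | 1.4508 |
As β → ∞: `maxᵢ log Fᵢ(β) = 36.2175·β + log 15 + o(1)` (corner 3, re-tilted minimum in sector(s) k = [8], shield offset n = 4); asymptotic gain `6 log 2 − log 15 = 1.4508`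
(the finite-β gains above are smaller whenever a corner's next sector lies close to its minimum). HONEST FRAMING: CERTIFIED inequalities on a SCREENING-GRADE object (U-slice /
companion per EMERY-LINE; box ends [float]/DFT with locators in the router's BOXES files); the re-tilt moves the β-SLOPE of the cap, the Markov reading moves only the CONSTANT
(of the `6 log 2 = 4.1589`); the cap−floor slope mismatch of the T = 0 words is unchanged — thermal scales are NOT resolved; grand-canonical statements at a stated level;
no phase word; no router number moves. WHAT-THIS-IS-NOT: a certificate or a number of record — a reading of existing kernel tables through two laws (zero kit).
-/

noncomputable section

namespace Summit.Ventures.CertifiedManyBodySolver.Downfold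

open NonemptyInterval Matrix Finset Literature.Probability.LatticeModels
open Literature.MathematicalPhysics.QuantumLattice Literature.Computation.Certificates
open Summit.Ventures.CertifiedManyBodySolver.Certificates OccupationCode ClusterLowerBound
open scoped BigOperators ComplexOrder

/-- Each Markov sum is positive (its `j = 0` term is an exponential). [folklore] -/
private theorem sum_choose_exp_pos' (g : ℕ → ℝ) : 0 < ∑ j ∈ Finset.range 7, ((Nat.choose 6 j : ℕ) : ℝ) * Real.exp (g j) :=
  lt_of_lt_of_le (mul_pos (by norm_num) (Real.exp_pos (g 0)))
    (Finset.single_le_sum (f := fun j => ((Nat.choose 6 j : ℕ) : ℝ) * Real.exp (g j)) (fun j _ => by positivity)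
      (Finset.mem_range.2 (by norm_num)))

/-! ## §1 The four sector tables in dictionary form -/

/-- **Sector table, corner 0** (tilt `μ = -8`): the kernel table `kgp1x5_NCCOx_c0_ll_mum80o10_table` in dictionary form, `θ = emeryLine cuprateSigns (nCCOK26Corner 0) + (-8)·levelDir`.
[cite: KullEtAl2024, §5.3] -/
theorem nCCOK26Floor_table0 : ∀ k ≤ 10, ((kgp1x5_NCCOx_c0_ll_mum80o10_sigma k : ℚ) : ℝ) ≤
    groundEnergy (hubbardOpenBoxGP 1 5 (plusTau (emeryLine cuprateSigns (nCCOK26Corner 0) + (-8 : ℝ) • levelDir) 2)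
      (plusUps (emeryLine cuprateSigns (nCCOK26Corner 0) + (-8 : ℝ) • levelDir) 2)
      (plusNu (emeryLine cuprateSigns (nCCOK26Corner 0) + (-8 : ℝ) • levelDir) 2)) k := by
  intro k hk
  have h := kgp1x5_NCCOx_c0_ll_mum80o10_table k hk
  rw [nCCOK26Floor_tau0, nCCOK26Floor_ups0, nCCOK26Floor_nu0] at h
  exact h

/-- **Sector table, corner 1** (tilt `μ = -9`): the kernel table `kgp1x5_NCCOx_c1_hl_mum90o10_table` in dictionary form, `θ = emeryLine cuprateSigns (nCCOK26Corner 1) + (-9)·levelDir`.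
[cite: KullEtAl2024, §5.3] -/
theorem nCCOK26Floor_table1 : ∀ k ≤ 10, ((kgp1x5_NCCOx_c1_hl_mum90o10_sigma k : ℚ) : ℝ) ≤
    groundEnergy (hubbardOpenBoxGP 1 5 (plusTau (emeryLine cuprateSigns (nCCOK26Corner 1) + (-9 : ℝ) • levelDir) 2)
      (plusUps (emeryLine cuprateSigns (nCCOK26Corner 1) + (-9 : ℝ) • levelDir) 2)
      (plusNu (emeryLine cuprateSigns (nCCOK26Corner 1) + (-9 : ℝ) • levelDir) 2)) k := by
  intro k hk
  have h := kgp1x5_NCCOx_c1_hl_mum90o10_table k hk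
  rw [nCCOK26Floor_tau1, nCCOK26Floor_ups1, nCCOK26Floor_nu1] at h
  exact h

/-- **Sector table, corner 2** (tilt `μ = -43/5`): the kernel table `kgp1x5_NCCOx_c2_lh_mum86o10_table` in dictionary form, `θ = emeryLine cuprateSigns (nCCOK26Corner 2) + (-43/5)·levelDir`.
[cite: KullEtAl2024, §5.3] -/
theorem nCCOK26Floor_table2 : ∀ k ≤ 10, ((kgp1x5_NCCOx_c2_lh_mum86o10_sigma k : ℚ) : ℝ) ≤
    groundEnergy (hubbardOpenBoxGP 1 5 (plusTau (emeryLine cuprateSigns (nCCOK26Corner 2) + (-43/5 : ℝ) • levelDir) 2)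
      (plusUps (emeryLine cuprateSigns (nCCOK26Corner 2) + (-43/5 : ℝ) • levelDir) 2)
      (plusNu (emeryLine cuprateSigns (nCCOK26Corner 2) + (-43/5 : ℝ) • levelDir) 2)) k := by
  intro k hk
  have h := kgp1x5_NCCOx_c2_lh_mum86o10_table k hk
  rw [nCCOK26Floor_tau2, nCCOK26Floor_ups2, nCCOK26Floor_nu2] at h
  exact h

/-- **Sector table, corner 3** (tilt `μ = -19/2`): the kernel table `kgp1x5_NCCOx_c3_hh_mum95o10_table` in dictionary form, `θ = emeryLine cuprateSigns (nCCOK26Corner 3) + (-19/2)·levelDir`.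
[cite: KullEtAl2024, §5.3] -/
theorem nCCOK26Floor_table3 : ∀ k ≤ 10, ((kgp1x5_NCCOx_c3_hh_mum95o10_sigma k : ℚ) : ℝ) ≤
    groundEnergy (hubbardOpenBoxGP 1 5 (plusTau (emeryLine cuprateSigns (nCCOK26Corner 3) + (-19/2 : ℝ) • levelDir) 2)
      (plusUps (emeryLine cuprateSigns (nCCOK26Corner 3) + (-19/2 : ℝ) • levelDir) 2)
      (plusNu (emeryLine cuprateSigns (nCCOK26Corner 3) + (-19/2 : ℝ) • levelDir) 2)) k := by
  intro k hk
  have h := kgp1x5_NCCOx_c3_hh_mum95o10_table k hk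
  rw [nCCOK26Floor_tau3, nCCOK26Floor_ups3, nCCOK26Floor_nu3] at h
  exact h

/-! ## §2 Level εp = -8: re-tilted certificates and the re-tilted flat cap word -/

/-- **Re-tilted certificate, corner 0 at level -8** (from tilt `-8`, `c = 0`; binding sector `k = 8`):
`H^(w_2)_(W₅)[emeryInteraction (θ_0 + (-8)·levelDir)] + 0 − (-2654597/40000)·1 ⪰ 0` (slope `−q₀′/2 = 33.1825`). [cite: KullEtAl2024, §5.3] [cite: ValentiStolzeHirschfeld1991, §II] -/
theorem nCCOK26Retilt_hq_m8_c0 :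
    ((⟨fun X => (uniformPeriodicWeight liebPeriods emeryCuO4Window 2 X : ℂ) •
        (emeryInteraction (emeryLine cuprateSigns (nCCOK26Corner 0) + ((-8 : ℚ) : ℝ) • levelDir)).Φ X⟩ : FermionInteraction 2).localHamiltonian
        emeryCuO4Window + (0 : FermionOp emeryCuO4Window) - ((-2654597/40000 : ℝ) : ℂ) • (1 : FermionOp emeryCuO4Window)).PosSemidef := by
  have h := posSemidef_cuO4_uniform_retilt_of_sectorFloors (emeryLine cuprateSigns (nCCOK26Corner 0) + (-8 : ℝ) • levelDir) 2 (0 : ℝ)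
    (σ := fun k => ((kgp1x5_NCCOx_c0_ll_mum80o10_sigma k : ℚ) : ℝ)) nCCOK26Floor_table0 (q := (-2654597/40000 : ℝ)) (fun k hk => by
      interval_cases k <;> norm_num [kgp1x5_NCCOx_c0_ll_mum80o10_sigma, max_def, min_def])
  rw [tilt_add_retilt, show (-8 : ℝ) + 0 = ((-8 : ℚ) : ℝ) by norm_num] at h
  exact h

/-- **Re-tilted certificate, corner 1 at level -8** (from tilt `-9`, `c = 1`; binding sector `k = 8`):
`H^(w_2)_(W₅)[emeryInteraction (θ_1 + (-8)·levelDir)] + 0 − (-5639593/80000)·1 ⪰ 0` (slope `−q₀′/2 = 35.2475`). [cite: KullEtAl2024, §5.3] [cite: ValentiStolzeHirschfeld1991, §II] -/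
theorem nCCOK26Retilt_hq_m8_c1 :
    ((⟨fun X => (uniformPeriodicWeight liebPeriods emeryCuO4Window 2 X : ℂ) •
        (emeryInteraction (emeryLine cuprateSigns (nCCOK26Corner 1) + ((-8 : ℚ) : ℝ) • levelDir)).Φ X⟩ : FermionInteraction 2).localHamiltonian
        emeryCuO4Window + (0 : FermionOp emeryCuO4Window) - ((-5639593/80000 : ℝ) : ℂ) • (1 : FermionOp emeryCuO4Window)).PosSemidef := by
  have h := posSemidef_cuO4_uniform_retilt_of_sectorFloors (emeryLine cuprateSigns (nCCOK26Corner 1) + (-9 : ℝ) • levelDir) 2 (1 : ℝ)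
    (σ := fun k => ((kgp1x5_NCCOx_c1_hl_mum90o10_sigma k : ℚ) : ℝ)) nCCOK26Floor_table1 (q := (-5639593/80000 : ℝ)) (fun k hk => by
      interval_cases k <;> norm_num [kgp1x5_NCCOx_c1_hl_mum90o10_sigma, max_def, min_def])
  rw [tilt_add_retilt, show (-9 : ℝ) + 1 = ((-8 : ℚ) : ℝ) by norm_num] at h
  exact h

/-- **Re-tilted certificate, corner 2 at level -8** (from tilt `-43/5`, `c = 3/5`; binding sector `k = 8`):
`H^(w_2)_(W₅)[emeryInteraction (θ_2 + (-8)·levelDir)] + 0 − (-5480573/80000)·1 ⪰ 0` (slope `−q₀′/2 = 34.2536`). [cite: KullEtAl2024, §5.3] [cite: ValentiStolzeHirschfeld1991, §II] -/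
theorem nCCOK26Retilt_hq_m8_c2 :
    ((⟨fun X => (uniformPeriodicWeight liebPeriods emeryCuO4Window 2 X : ℂ) •
        (emeryInteraction (emeryLine cuprateSigns (nCCOK26Corner 2) + ((-8 : ℚ) : ℝ) • levelDir)).Φ X⟩ : FermionInteraction 2).localHamiltonian
        emeryCuO4Window + (0 : FermionOp emeryCuO4Window) - ((-5480573/80000 : ℝ) : ℂ) • (1 : FermionOp emeryCuO4Window)).PosSemidef := by
  have h := posSemidef_cuO4_uniform_retilt_of_sectorFloors (emeryLine cuprateSigns (nCCOK26Corner 2) + (-43/5 : ℝ) • levelDir) 2 (3/5 : ℝ)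
    (σ := fun k => ((kgp1x5_NCCOx_c2_lh_mum86o10_sigma k : ℚ) : ℝ)) nCCOK26Floor_table2 (q := (-5480573/80000 : ℝ)) (fun k hk => by
      interval_cases k <;> norm_num [kgp1x5_NCCOx_c2_lh_mum86o10_sigma, max_def, min_def])
  rw [tilt_add_retilt, show (-43/5 : ℝ) + 3/5 = ((-8 : ℚ) : ℝ) by norm_num] at h
  exact h

/-- **Re-tilted certificate, corner 3 at level -8** (from tilt `-19/2`, `c = 3/2`; binding sector `k = 8`):
`H^(w_2)_(W₅)[emeryInteraction (θ_3 + (-8)·levelDir)] + 0 − (-2897403/40000)·1 ⪰ 0` (slope `−q₀′/2 = 36.2175`). [cite: KullEtAl2024, §5.3] [cite: ValentiStolzeHirschfeld1991, §II] -/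
theorem nCCOK26Retilt_hq_m8_c3 :
    ((⟨fun X => (uniformPeriodicWeight liebPeriods emeryCuO4Window 2 X : ℂ) •
        (emeryInteraction (emeryLine cuprateSigns (nCCOK26Corner 3) + ((-8 : ℚ) : ℝ) • levelDir)).Φ X⟩ : FermionInteraction 2).localHamiltonian
        emeryCuO4Window + (0 : FermionOp emeryCuO4Window) - ((-2897403/40000 : ℝ) : ℂ) • (1 : FermionOp emeryCuO4Window)).PosSemidef := by
  have h := posSemidef_cuO4_uniform_retilt_of_sectorFloors (emeryLine cuprateSigns (nCCOK26Corner 3) + (-19/2 : ℝ) • levelDir) 2 (3/2 : ℝ)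
    (σ := fun k => ((kgp1x5_NCCOx_c3_hh_mum95o10_sigma k : ℚ) : ℝ)) nCCOK26Floor_table3 (q := (-2897403/40000 : ℝ)) (fun k hk => by
      interval_cases k <;> norm_num [kgp1x5_NCCOx_c3_hh_mum95o10_sigma, max_def, min_def])
  rw [tilt_add_retilt, show (-19/2 : ℝ) + 3/2 = ((-8 : ℚ) : ℝ) by norm_num] at h
  exact h

/-- Every re-tilted corner slope at level -8 is at most `2897403/80000 = 36.2175375` (corner 3 binds). [folklore] -/
theorem nCCOK26Retilt_c_le_m8 (i : Fin 4) :
    -((![-2654597/40000, -5639593/80000, -5480573/80000, -2897403/40000] : Fin 4 → ℝ) i) / 2 ≤ (2897403/80000 : ℝ) := by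
  fin_cases i <;> simp <;> norm_num

/-- **THE RE-TILTED CAP WORD at level εp = -8** (hypothesis-free, every β ≥ 0, every point of `emeryBoxNCCOK26`): `P_cell ≤ 6 log 2 + β·2897403/80000`
(`36.2175·β + 4.1589`) — versus `3377403/80000 = 42.2175` by monotone transfer (`emeryBoxNCCOK26_pressureCap_m8`).
[cite: Israel1979, Thm. I.2.4] [cite: ValentiStolzeHirschfeld1991, §II] -/
theorem emeryBoxNCCOK26_pressureCap_m8_retilt {β : ℝ} (hβ : 0 ≤ β) :
    HoldsOn (fun p : EmeryCoord → ℝ =>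
      emeryCellPressure β (emeryLine cuprateSigns (emeryLineCoords (((-8 : ℚ)) : ℝ) p)) ≤ 6 * Real.log 2 + β * (2897403/80000 : ℝ)) emeryBoxNCCOK26 :=
  holdsOn_emeryCellPressureCap_of_tiltedCuO4Certificates (E := emeryBoxNCCOK26) (eA := nccoK26Emery_tpd) (eB := nccoK26Emery_tpp) (eD := nccoK26Emery_Delta) (eUd := nccoK26Emery_Udd) (eUp := nccoK26Emery_Upp) (by simp [emeryBoxNCCOK26, emeryBoxNCCOK26Src, Function.update]) (by simp [emeryBoxNCCOK26, emeryBoxNCCOK26Src, Function.update]) (Function.update_self _ _ _) (by simp [emeryBoxNCCOK26, emeryBoxNCCOK26Src, Function.update]) (by simp [emeryBoxNCCOK26, emeryBoxNCCOK26Src, Function.update]) cuprateSigns hβ (M := 2) two_pos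
    (fun _ => 0) (fun _ ω' _ => re_expect_zero_cuO4 ω') (fun _ => (((-8 : ℚ)) : ℝ))
    (![-2654597/40000, -5639593/80000, -5480573/80000, -2897403/40000] : Fin 4 → ℝ)
    (fun i => by
      rw [nCCOK26_lowerCorner]
      fin_cases i
      · simpa using nCCOK26Retilt_hq_m8_c0
      · simpa using nCCOK26Retilt_hq_m8_c1
      · simpa using nCCOK26Retilt_hq_m8_c2
      · simpa using nCCOK26Retilt_hq_m8_c3)
    (fun _ => le_rfl) (fun i => by have h := nCCOK26Retilt_c_le_m8 i; simpa [div_eq_mul_inv] using h)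

/-- **Grand-potential reading at level -8** (chemical potential `8` eV): for every `T > 0` and every point of the box,
`Ω/CuO₂ = −P_cell/β ≥ −2897403/80000 − 6 log 2/β`. [cite: Israel1979, Thm. I.2.4] -/
theorem emeryBoxNCCOK26_grandPotential_ge_m8_retilt {β : ℝ} (hβ : 0 < β) :
    HoldsOn (fun p : EmeryCoord → ℝ =>
      -(2897403/80000 : ℝ) - 6 * Real.log 2 / β ≤ -emeryCellPressure β (emeryLine cuprateSigns (emeryLineCoords (((-8 : ℚ)) : ℝ) p)) / β) emeryBoxNCCOK26 :=
  holdsOn_grandPotential_ge_of_pressureCap cuprateSigns hβ _ (emeryBoxNCCOK26_pressureCap_m8_retilt hβ.le)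

/-! ## §3 The four sector tables re-tilted to the common level εp = -8, sector by sector -/

/-- **Corner 0, level -8** (from tilt `-8`, `c = 0`): `σ_0(k) + max(0·k + min(0, 2·0), 2·0·k − 4·max(0, 2·0)) ≤ E₀(h^G(θ_0 + (-8)·ε), k)`, `k ≤ 10`.
[cite: KullEtAl2024, §5.3] [cite: ValentiStolzeHirschfeld1991, §II] -/
theorem nCCOK26MarkovTable_m8_c0 : ∀ k ≤ 10,
    ((kgp1x5_NCCOx_c0_ll_mum80o10_sigma k : ℚ) : ℝ) + max ((0 : ℝ) * 2 / 2 * k + min 0 ((0 : ℝ) * 2)) ((0 : ℝ) * 2 * k - 4 * max 0 ((0 : ℝ) * 2)) ≤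
      groundEnergy (hubbardOpenBoxGP 1 5 (plusTau (emeryLine cuprateSigns (nCCOK26Corner 0) + ((-8 : ℚ) : ℝ) • levelDir) 2)
        (plusUps (emeryLine cuprateSigns (nCCOK26Corner 0) + ((-8 : ℚ) : ℝ) • levelDir) 2)
        (plusNu (emeryLine cuprateSigns (nCCOK26Corner 0) + ((-8 : ℚ) : ℝ) • levelDir) 2)) k := by
  have h := sectorFloors_plusGP_retilt (emeryLine cuprateSigns (nCCOK26Corner 0) + (-8 : ℝ) • levelDir) 2 (0 : ℝ) nCCOK26Floor_table0
  rw [tilt_add_retilt, show (-8 : ℝ) + 0 = ((-8 : ℚ) : ℝ) by norm_num] at h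
  exact h

/-- **Corner 1, level -8** (from tilt `-9`, `c = 1`): `σ_1(k) + max(1·k + min(0, 2·1), 2·1·k − 4·max(0, 2·1)) ≤ E₀(h^G(θ_1 + (-8)·ε), k)`, `k ≤ 10`.
[cite: KullEtAl2024, §5.3] [cite: ValentiStolzeHirschfeld1991, §II] -/
theorem nCCOK26MarkovTable_m8_c1 : ∀ k ≤ 10,
    ((kgp1x5_NCCOx_c1_hl_mum90o10_sigma k : ℚ) : ℝ) + max ((1 : ℝ) * 2 / 2 * k + min 0 ((1 : ℝ) * 2)) ((1 : ℝ) * 2 * k - 4 * max 0 ((1 : ℝ) * 2)) ≤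
      groundEnergy (hubbardOpenBoxGP 1 5 (plusTau (emeryLine cuprateSigns (nCCOK26Corner 1) + ((-8 : ℚ) : ℝ) • levelDir) 2)
        (plusUps (emeryLine cuprateSigns (nCCOK26Corner 1) + ((-8 : ℚ) : ℝ) • levelDir) 2)
        (plusNu (emeryLine cuprateSigns (nCCOK26Corner 1) + ((-8 : ℚ) : ℝ) • levelDir) 2)) k := by
  have h := sectorFloors_plusGP_retilt (emeryLine cuprateSigns (nCCOK26Corner 1) + (-9 : ℝ) • levelDir) 2 (1 : ℝ) nCCOK26Floor_table1
  rw [tilt_add_retilt, show (-9 : ℝ) + 1 = ((-8 : ℚ) : ℝ) by norm_num] at h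
  exact h

/-- **Corner 2, level -8** (from tilt `-43/5`, `c = 3/5`): `σ_2(k) + max(3/5·k + min(0, 2·3/5), 2·3/5·k − 4·max(0, 2·3/5)) ≤ E₀(h^G(θ_2 + (-8)·ε), k)`, `k ≤ 10`.
[cite: KullEtAl2024, §5.3] [cite: ValentiStolzeHirschfeld1991, §II] -/
theorem nCCOK26MarkovTable_m8_c2 : ∀ k ≤ 10,
    ((kgp1x5_NCCOx_c2_lh_mum86o10_sigma k : ℚ) : ℝ) + max ((3/5 : ℝ) * 2 / 2 * k + min 0 ((3/5 : ℝ) * 2)) ((3/5 : ℝ) * 2 * k - 4 * max 0 ((3/5 : ℝ) * 2)) ≤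
      groundEnergy (hubbardOpenBoxGP 1 5 (plusTau (emeryLine cuprateSigns (nCCOK26Corner 2) + ((-8 : ℚ) : ℝ) • levelDir) 2)
        (plusUps (emeryLine cuprateSigns (nCCOK26Corner 2) + ((-8 : ℚ) : ℝ) • levelDir) 2)
        (plusNu (emeryLine cuprateSigns (nCCOK26Corner 2) + ((-8 : ℚ) : ℝ) • levelDir) 2)) k := by
  have h := sectorFloors_plusGP_retilt (emeryLine cuprateSigns (nCCOK26Corner 2) + (-43/5 : ℝ) • levelDir) 2 (3/5 : ℝ) nCCOK26Floor_table2
  rw [tilt_add_retilt, show (-43/5 : ℝ) + 3/5 = ((-8 : ℚ) : ℝ) by norm_num] at h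
  exact h

/-- **Corner 3, level -8** (from tilt `-19/2`, `c = 3/2`): `σ_3(k) + max(3/2·k + min(0, 2·3/2), 2·3/2·k − 4·max(0, 2·3/2)) ≤ E₀(h^G(θ_3 + (-8)·ε), k)`, `k ≤ 10`.
[cite: KullEtAl2024, §5.3] [cite: ValentiStolzeHirschfeld1991, §II] -/
theorem nCCOK26MarkovTable_m8_c3 : ∀ k ≤ 10,
    ((kgp1x5_NCCOx_c3_hh_mum95o10_sigma k : ℚ) : ℝ) + max ((3/2 : ℝ) * 2 / 2 * k + min 0 ((3/2 : ℝ) * 2)) ((3/2 : ℝ) * 2 * k - 4 * max 0 ((3/2 : ℝ) * 2)) ≤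
      groundEnergy (hubbardOpenBoxGP 1 5 (plusTau (emeryLine cuprateSigns (nCCOK26Corner 3) + ((-8 : ℚ) : ℝ) • levelDir) 2)
        (plusUps (emeryLine cuprateSigns (nCCOK26Corner 3) + ((-8 : ℚ) : ℝ) • levelDir) 2)
        (plusNu (emeryLine cuprateSigns (nCCOK26Corner 3) + ((-8 : ℚ) : ℝ) • levelDir) 2)) k := by
  have h := sectorFloors_plusGP_retilt (emeryLine cuprateSigns (nCCOK26Corner 3) + (-19/2 : ℝ) • levelDir) 2 (3/2 : ℝ) nCCOK26Floor_table3
  rw [tilt_add_retilt, show (-19/2 : ℝ) + 3/2 = ((-8 : ℚ) : ℝ) by norm_num] at h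
  exact h

/-! ## §4 The four entropy-resolved corner caps at level εp = -8 -/

/-- **CORNER 0, entropy-resolved cap** at level -8 (every β ≥ 0): `P_cell ≤ log max_{n≤4} Σ_{j≤6} C(6,j)·e^{−(β/2)·q_0(j+n)}`, `q_0(k) = σ_0(k) + max(0·k + min(0,2·0), 2·0·k − 4·max(0,2·0))`
(as β → ∞: `33.1825·β + log 15`, minimum in sector(s) k = [8]). [cite: PoulinHastings2011, eqs. (3)–(8)] [cite: Israel1979, Thm. I.2.4] -/
theorem emeryBoxNCCOK26_corner0_pressureCap_m8_markov {β : ℝ} (hβ : 0 ≤ β) :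
    emeryCellPressure β (emeryLine cuprateSigns (nCCOK26Corner 0) + ((-8 : ℚ) : ℝ) • levelDir) ≤
      Real.log ((Finset.range 5).sup' ⟨0, by simp⟩ fun n => ∑ j ∈ Finset.range 7, ((Nat.choose 6 j : ℕ) : ℝ) *
        Real.exp (-(β / 2 * (((kgp1x5_NCCOx_c0_ll_mum80o10_sigma (j + n) : ℚ) : ℝ) +
          max ((0 : ℝ) * 2 / 2 * (j + n : ℕ) + min 0 ((0 : ℝ) * 2)) ((0 : ℝ) * 2 * (j + n : ℕ) - 4 * max 0 ((0 : ℝ) * 2)))))) := by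
  refine emeryCellPressure_le_log_of_gpSectorFloors _ (M := 2) two_pos hβ _ nCCOK26MarkovTable_m8_c0 ?_ fun n hn => ?_
  · exact lt_of_lt_of_le (sum_choose_exp_pos' _) (Finset.le_sup' (fun n => ∑ j ∈ Finset.range 7, ((Nat.choose 6 j : ℕ) : ℝ) *
        Real.exp (-(β / 2 * (((kgp1x5_NCCOx_c0_ll_mum80o10_sigma (j + n) : ℚ) : ℝ) +
          max ((0 : ℝ) * 2 / 2 * (j + n : ℕ) + min 0 ((0 : ℝ) * 2)) ((0 : ℝ) * 2 * (j + n : ℕ) - 4 * max 0 ((0 : ℝ) * 2)))))) (Finset.mem_range.2 (by norm_num : 0 < 5)))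
  · exact Finset.le_sup' (fun n => ∑ j ∈ Finset.range 7, ((Nat.choose 6 j : ℕ) : ℝ) *
        Real.exp (-(β / 2 * (((kgp1x5_NCCOx_c0_ll_mum80o10_sigma (j + n) : ℚ) : ℝ) +
          max ((0 : ℝ) * 2 / 2 * (j + n : ℕ) + min 0 ((0 : ℝ) * 2)) ((0 : ℝ) * 2 * (j + n : ℕ) - 4 * max 0 ((0 : ℝ) * 2)))))) (Finset.mem_range.2 (by omega))

/-- **CORNER 1, entropy-resolved cap** at level -8 (every β ≥ 0): `P_cell ≤ log max_{n≤4} Σ_{j≤6} C(6,j)·e^{−(β/2)·q_1(j+n)}`, `q_1(k) = σ_1(k) + max(1·k + min(0,2·1), 2·1·k − 4·max(0,2·1))`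
(as β → ∞: `35.2475·β + log 15`, minimum in sector(s) k = [8]). [cite: PoulinHastings2011, eqs. (3)–(8)] [cite: Israel1979, Thm. I.2.4] -/
theorem emeryBoxNCCOK26_corner1_pressureCap_m8_markov {β : ℝ} (hβ : 0 ≤ β) :
    emeryCellPressure β (emeryLine cuprateSigns (nCCOK26Corner 1) + ((-8 : ℚ) : ℝ) • levelDir) ≤
      Real.log ((Finset.range 5).sup' ⟨0, by simp⟩ fun n => ∑ j ∈ Finset.range 7, ((Nat.choose 6 j : ℕ) : ℝ) *
        Real.exp (-(β / 2 * (((kgp1x5_NCCOx_c1_hl_mum90o10_sigma (j + n) : ℚ) : ℝ) +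
          max ((1 : ℝ) * 2 / 2 * (j + n : ℕ) + min 0 ((1 : ℝ) * 2)) ((1 : ℝ) * 2 * (j + n : ℕ) - 4 * max 0 ((1 : ℝ) * 2)))))) := by
  refine emeryCellPressure_le_log_of_gpSectorFloors _ (M := 2) two_pos hβ _ nCCOK26MarkovTable_m8_c1 ?_ fun n hn => ?_
  · exact lt_of_lt_of_le (sum_choose_exp_pos' _) (Finset.le_sup' (fun n => ∑ j ∈ Finset.range 7, ((Nat.choose 6 j : ℕ) : ℝ) *
        Real.exp (-(β / 2 * (((kgp1x5_NCCOx_c1_hl_mum90o10_sigma (j + n) : ℚ) : ℝ) +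
          max ((1 : ℝ) * 2 / 2 * (j + n : ℕ) + min 0 ((1 : ℝ) * 2)) ((1 : ℝ) * 2 * (j + n : ℕ) - 4 * max 0 ((1 : ℝ) * 2)))))) (Finset.mem_range.2 (by norm_num : 0 < 5)))
  · exact Finset.le_sup' (fun n => ∑ j ∈ Finset.range 7, ((Nat.choose 6 j : ℕ) : ℝ) *
        Real.exp (-(β / 2 * (((kgp1x5_NCCOx_c1_hl_mum90o10_sigma (j + n) : ℚ) : ℝ) +
          max ((1 : ℝ) * 2 / 2 * (j + n : ℕ) + min 0 ((1 : ℝ) * 2)) ((1 : ℝ) * 2 * (j + n : ℕ) - 4 * max 0 ((1 : ℝ) * 2)))))) (Finset.mem_range.2 (by omega))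

/-- **CORNER 2, entropy-resolved cap** at level -8 (every β ≥ 0): `P_cell ≤ log max_{n≤4} Σ_{j≤6} C(6,j)·e^{−(β/2)·q_2(j+n)}`, `q_2(k) = σ_2(k) + max(3/5·k + min(0,2·3/5), 2·3/5·k − 4·max(0,2·3/5))`
(as β → ∞: `34.2536·β + log 15`, minimum in sector(s) k = [8]). [cite: PoulinHastings2011, eqs. (3)–(8)] [cite: Israel1979, Thm. I.2.4] -/
theorem emeryBoxNCCOK26_corner2_pressureCap_m8_markov {β : ℝ} (hβ : 0 ≤ β) :
    emeryCellPressure β (emeryLine cuprateSigns (nCCOK26Corner 2) + ((-8 : ℚ) : ℝ) • levelDir) ≤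
      Real.log ((Finset.range 5).sup' ⟨0, by simp⟩ fun n => ∑ j ∈ Finset.range 7, ((Nat.choose 6 j : ℕ) : ℝ) *
        Real.exp (-(β / 2 * (((kgp1x5_NCCOx_c2_lh_mum86o10_sigma (j + n) : ℚ) : ℝ) +
          max ((3/5 : ℝ) * 2 / 2 * (j + n : ℕ) + min 0 ((3/5 : ℝ) * 2)) ((3/5 : ℝ) * 2 * (j + n : ℕ) - 4 * max 0 ((3/5 : ℝ) * 2)))))) := by
  refine emeryCellPressure_le_log_of_gpSectorFloors _ (M := 2) two_pos hβ _ nCCOK26MarkovTable_m8_c2 ?_ fun n hn => ?_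
  · exact lt_of_lt_of_le (sum_choose_exp_pos' _) (Finset.le_sup' (fun n => ∑ j ∈ Finset.range 7, ((Nat.choose 6 j : ℕ) : ℝ) *
        Real.exp (-(β / 2 * (((kgp1x5_NCCOx_c2_lh_mum86o10_sigma (j + n) : ℚ) : ℝ) +
          max ((3/5 : ℝ) * 2 / 2 * (j + n : ℕ) + min 0 ((3/5 : ℝ) * 2)) ((3/5 : ℝ) * 2 * (j + n : ℕ) - 4 * max 0 ((3/5 : ℝ) * 2)))))) (Finset.mem_range.2 (by norm_num : 0 < 5)))
  · exact Finset.le_sup' (fun n => ∑ j ∈ Finset.range 7, ((Nat.choose 6 j : ℕ) : ℝ) *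
        Real.exp (-(β / 2 * (((kgp1x5_NCCOx_c2_lh_mum86o10_sigma (j + n) : ℚ) : ℝ) +
          max ((3/5 : ℝ) * 2 / 2 * (j + n : ℕ) + min 0 ((3/5 : ℝ) * 2)) ((3/5 : ℝ) * 2 * (j + n : ℕ) - 4 * max 0 ((3/5 : ℝ) * 2)))))) (Finset.mem_range.2 (by omega))

/-- **CORNER 3, entropy-resolved cap** at level -8 (every β ≥ 0): `P_cell ≤ log max_{n≤4} Σ_{j≤6} C(6,j)·e^{−(β/2)·q_3(j+n)}`, `q_3(k) = σ_3(k) + max(3/2·k + min(0,2·3/2), 2·3/2·k − 4·max(0,2·3/2))`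
(as β → ∞: `36.2175·β + log 15`, minimum in sector(s) k = [8]). [cite: PoulinHastings2011, eqs. (3)–(8)] [cite: Israel1979, Thm. I.2.4] -/
theorem emeryBoxNCCOK26_corner3_pressureCap_m8_markov {β : ℝ} (hβ : 0 ≤ β) :
    emeryCellPressure β (emeryLine cuprateSigns (nCCOK26Corner 3) + ((-8 : ℚ) : ℝ) • levelDir) ≤
      Real.log ((Finset.range 5).sup' ⟨0, by simp⟩ fun n => ∑ j ∈ Finset.range 7, ((Nat.choose 6 j : ℕ) : ℝ) *
        Real.exp (-(β / 2 * (((kgp1x5_NCCOx_c3_hh_mum95o10_sigma (j + n) : ℚ) : ℝ) +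
          max ((3/2 : ℝ) * 2 / 2 * (j + n : ℕ) + min 0 ((3/2 : ℝ) * 2)) ((3/2 : ℝ) * 2 * (j + n : ℕ) - 4 * max 0 ((3/2 : ℝ) * 2)))))) := by
  refine emeryCellPressure_le_log_of_gpSectorFloors _ (M := 2) two_pos hβ _ nCCOK26MarkovTable_m8_c3 ?_ fun n hn => ?_
  · exact lt_of_lt_of_le (sum_choose_exp_pos' _) (Finset.le_sup' (fun n => ∑ j ∈ Finset.range 7, ((Nat.choose 6 j : ℕ) : ℝ) *
        Real.exp (-(β / 2 * (((kgp1x5_NCCOx_c3_hh_mum95o10_sigma (j + n) : ℚ) : ℝ) +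
          max ((3/2 : ℝ) * 2 / 2 * (j + n : ℕ) + min 0 ((3/2 : ℝ) * 2)) ((3/2 : ℝ) * 2 * (j + n : ℕ) - 4 * max 0 ((3/2 : ℝ) * 2)))))) (Finset.mem_range.2 (by norm_num : 0 < 5)))
  · exact Finset.le_sup' (fun n => ∑ j ∈ Finset.range 7, ((Nat.choose 6 j : ℕ) : ℝ) *
        Real.exp (-(β / 2 * (((kgp1x5_NCCOx_c3_hh_mum95o10_sigma (j + n) : ℚ) : ℝ) +
          max ((3/2 : ℝ) * 2 / 2 * (j + n : ℕ) + min 0 ((3/2 : ℝ) * 2)) ((3/2 : ℝ) * 2 * (j + n : ℕ) - 4 * max 0 ((3/2 : ℝ) * 2)))))) (Finset.mem_range.2 (by omega))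

/-! ## §5 The entropy-resolved box word -/

/-- **THE ENTROPY-RESOLVED `T > 0` CAP WORD on `emeryBoxNCCOK26`** (hypothesis-free, every β ≥ 0, every point, level εp = -8 ⇔ chemical potential `8` eV):
`P_cell(β) ≤ maxᵢ log Fᵢ(β)` with the four corner functions of §4 [as β → ∞: `36.2175·β + log 15` = `36.2175·β + 2.7081`; float table in the module
docstring] versus the flat re-tilted word `36.2175·β + 4.1589` of `emeryBoxNCCOK26_pressureCap_m8_retilt`. [cite: Israel1979, Thm. I.3.4] [cite: PoulinHastings2011, eqs. (3)–(8)] -/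
theorem emeryBoxNCCOK26_pressureCap_m8_markov {β : ℝ} (hβ : 0 ≤ β) :
    HoldsOn (fun p : EmeryCoord → ℝ =>
      emeryCellPressure β (emeryLine cuprateSigns (emeryLineCoords (((-8 : ℚ)) : ℝ) p)) ≤
        max (max
          (Real.log ((Finset.range 5).sup' ⟨0, by simp⟩ fun n => ∑ j ∈ Finset.range 7, ((Nat.choose 6 j : ℕ) : ℝ) *
        Real.exp (-(β / 2 * (((kgp1x5_NCCOx_c0_ll_mum80o10_sigma (j + n) : ℚ) : ℝ) +
          max ((0 : ℝ) * 2 / 2 * (j + n : ℕ) + min 0 ((0 : ℝ) * 2)) ((0 : ℝ) * 2 * (j + n : ℕ) - 4 * max 0 ((0 : ℝ) * 2)))))))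
          (Real.log ((Finset.range 5).sup' ⟨0, by simp⟩ fun n => ∑ j ∈ Finset.range 7, ((Nat.choose 6 j : ℕ) : ℝ) *
        Real.exp (-(β / 2 * (((kgp1x5_NCCOx_c1_hl_mum90o10_sigma (j + n) : ℚ) : ℝ) +
          max ((1 : ℝ) * 2 / 2 * (j + n : ℕ) + min 0 ((1 : ℝ) * 2)) ((1 : ℝ) * 2 * (j + n : ℕ) - 4 * max 0 ((1 : ℝ) * 2))))))))
          (max
          (Real.log ((Finset.range 5).sup' ⟨0, by simp⟩ fun n => ∑ j ∈ Finset.range 7, ((Nat.choose 6 j : ℕ) : ℝ) *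
        Real.exp (-(β / 2 * (((kgp1x5_NCCOx_c2_lh_mum86o10_sigma (j + n) : ℚ) : ℝ) +
          max ((3/5 : ℝ) * 2 / 2 * (j + n : ℕ) + min 0 ((3/5 : ℝ) * 2)) ((3/5 : ℝ) * 2 * (j + n : ℕ) - 4 * max 0 ((3/5 : ℝ) * 2)))))))
          (Real.log ((Finset.range 5).sup' ⟨0, by simp⟩ fun n => ∑ j ∈ Finset.range 7, ((Nat.choose 6 j : ℕ) : ℝ) *
        Real.exp (-(β / 2 * (((kgp1x5_NCCOx_c3_hh_mum95o10_sigma (j + n) : ℚ) : ℝ) +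
          max ((3/2 : ℝ) * 2 / 2 * (j + n : ℕ) + min 0 ((3/2 : ℝ) * 2)) ((3/2 : ℝ) * 2 * (j + n : ℕ) - 4 * max 0 ((3/2 : ℝ) * 2)))))))))
      emeryBoxNCCOK26 := by
  refine holdsOn_emeryCellPressureCap_of_cornerCaps (E := emeryBoxNCCOK26) (eA := nccoK26Emery_tpd) (eB := nccoK26Emery_tpp) (eD := nccoK26Emery_Delta) (eUd := nccoK26Emery_Udd) (eUp := nccoK26Emery_Upp) (by simp [emeryBoxNCCOK26, emeryBoxNCCOK26Src, Function.update]) (by simp [emeryBoxNCCOK26, emeryBoxNCCOK26Src, Function.update]) (Function.update_self _ _ _) (by simp [emeryBoxNCCOK26, emeryBoxNCCOK26Src, Function.update]) (by simp [emeryBoxNCCOK26, emeryBoxNCCOK26Src, Function.update]) cuprateSigns hβ fun i => ?_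
  rw [emeryLine_lowerCorner_level, nCCOK26_lowerCorner]
  fin_cases i
  · exact le_max_of_le_left (le_max_of_le_left (emeryBoxNCCOK26_corner0_pressureCap_m8_markov hβ))
  · exact le_max_of_le_left (le_max_of_le_right (emeryBoxNCCOK26_corner1_pressureCap_m8_markov hβ))
  · exact le_max_of_le_right (le_max_of_le_left (emeryBoxNCCOK26_corner2_pressureCap_m8_markov hβ))
  · exact le_max_of_le_right (le_max_of_le_right (emeryBoxNCCOK26_corner3_pressureCap_m8_markov hβ))

end Summit.Ventures.CertifiedManyBodySolver.Downfold

end
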